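import Mathlib
import Literature.NumberTheory.LFunctions.Zhang2022.Section7cProofs
import Literature.NumberTheory.LFunctions.Zhang2022.SkeletonWindowPowers
import HarnessLib

/-!
# Zhang (2022), §7 step `Z22:§7.u031` discharged: reduction of the non-principal `θ (mod k)` of
(7.12) to primitive characters

Topic `Literature/NumberTheory/LFunctions/Zhang2022` (Landau–Siegel audit tree; verdict-neutral).
Y. Zhang, *Discrete mean estimates and the Landau–Siegel zero*, arXiv:2211.02515v1 (2022)
[Zhang2022LandauSiegel] — an unrefereed manuscript under adjudication. This file PROVES the typed
claim `Section7cStatements.Step7u031 c'` (DAG node `Z22:§7.u031`, tex L1998, p. 37: "Thus, the inner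
sum over the non-principal `θ (mod k)` above is
`≪ Σ_{hr=k, r>1} r^{1/2} Σ*_{θ mod r} |𝔰(r,h,d;θ)|`") for every `c'`, with the constant `C = 1`
and no largeness threshold (`D₀ = 0`).

Route (classical): every non-principal `θ (mod k)` is induced by a unique primitive `θ* (mod r)`,
`r = conductor θ > 1`, `k = hr` (Mathlib `changeLevel_primitiveCharacter`, `conductor_changeLevel`,
`changeLevel_injective`); on the support range `dk < PT⁻²` every `p ∼ P` is coprime to `k`, so
`θ(l) = θ*(l)·1_{(l,h)=1}` and `θ̄(−p) = θ̄*(−1)θ̄*(p)` (`changeLevel_eq_cast_of_dvd'`), whence the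
`θ`-term of (7.12) equals `τ(θ̄)·θ̄*(−1)·𝔰(r,h,d;θ*)` exactly; `|θ̄*(−1)| ≤ 1` and
`|τ(θ̄)| ≤ r^{1/2}` (`Section7cStatements.step7u031tau_holds`, slice L2-t4) finish the term bound,
and the sum over `θ ≠ 1` is re-indexed injectively into `Σ_{hr = k} Σ_{θ* mod r primitive}`.

WHAT THIS IS NOT: any claim about Theorems 1–2 of the manuscript or about Landau–Siegel zeros;
typed ≠ discharged elsewhere — this discharges exactly one prose step of §7.

## References

* Y. Zhang, arXiv:2211.02515v1 (2022), §7 p. 37, tex L1997–L2001.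
  [cite: Zhang2022LandauSiegel, §7 p. 37]
-/

noncomputable section

open Complex Real
open Literature.NumberTheory.LFunctions.Zhang2022

namespace Literature.NumberTheory.LFunctions.Zhang2022.Section7cStatements

/-! ## Values of an induced character -/

/-- An induced character agrees with the inducing one at integers coprime to the larger modulus.
[folklore] -/
private theorem changeLevel_natCast {n m : ℕ} (χ : DirichletCharacter ℂ n) (hm : n ∣ m) {a : ℕ}
    (ha : Nat.Coprime a m) :
    DirichletCharacter.changeLevel hm χ (a : ZMod m) = χ (a : ZMod n) := by
  have h := DirichletCharacter.changeLevel_eq_cast_of_dvd' χ hm (a := (a : ℤ))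
    (Nat.isCoprime_iff_coprime.mpr ha)
  simpa only [Int.cast_natCast] using h

/-- An induced character agrees with the inducing one at `−a` for `a` coprime to the larger
modulus. [folklore] -/
private theorem changeLevel_neg_natCast {n m : ℕ} (χ : DirichletCharacter ℂ n) (hm : n ∣ m)
    {a : ℕ} (ha : Nat.Coprime a m) :
    DirichletCharacter.changeLevel hm χ (-(a : ZMod m)) = χ (-(a : ZMod n)) := by
  have h := DirichletCharacter.changeLevel_eq_cast_of_dvd' χ hm (a := -(a : ℤ))
    (Nat.isCoprime_iff_coprime.mpr ha).neg_left
  simpa only [Int.cast_neg, Int.cast_natCast] using h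

/-- Transport of a level-indexed expression along an equality of levels, for an induced character.
[folklore] -/
private theorem changeLevel_transport {r k k' : ℕ} (F : (n : ℕ) → DirichletCharacter ℂ n → ℂ)
    (e : k = k') (hd : r ∣ k) (hd' : r ∣ k') (θs : DirichletCharacter ℂ r) :
    F k (DirichletCharacter.changeLevel hd θs) = F k' (DirichletCharacter.changeLevel hd' θs) := by
  subst e
  rfl

/-- Two induced characters of the same level with heterogeneously equal primitive data coincide.
[folklore] -/
private theorem changeLevel_heq {k c₁ c₂ : ℕ} (e : c₁ = c₂) {ψ₁ : DirichletCharacter ℂ c₁}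
    {ψ₂ : DirichletCharacter ℂ c₂} (hψ : HEq ψ₁ ψ₂) (h₁ : c₁ ∣ k) (h₂ : c₂ ∣ k) :
    DirichletCharacter.changeLevel h₁ ψ₁ = DirichletCharacter.changeLevel h₂ ψ₂ := by
  subst e
  obtain rfl := heq_iff_eq.mp hψ
  rfl

/-! ## The term of one induced character -/

/-- The `θ`-term of (7.12) for `θ (mod hr)` induced by a primitive `θ* (mod r)`, `r > 1`, when every
`p ∼ P` is coprime to `hr`: it is bounded by `r^{1/2}|𝔰(r,h,d;θ*)|`.
[cite: Zhang2022LandauSiegel, §7 p. 37, tex L1997–L2001] -/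
private theorem term_changeLevel_le (hτ : Step7u031tau) (c' : ℝ) (D : ℕ) (a₁ : ℕ → ℂ)
    (d h r : ℕ) (hh : 0 < h) (hr : 1 < r) (θs : DirichletCharacter ℂ r) (hθs : θs.IsPrimitive)
    (hcop : ∀ p ∈ Skeleton.primeWindow D, Nat.Coprime p (h * r)) :
    ‖gaussBar (h * r) (DirichletCharacter.changeLevel (Nat.dvd_mul_left r h) θs) *
        ∑' l : ℕ, MeanSquareMajorant.conv (Skeleton.kappaZ c' D) a₁ (d * l) *
            DirichletCharacter.changeLevel (Nat.dvd_mul_left r h) θs (l : ZMod (h * r)) *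
          ∑ p ∈ Skeleton.primeWindow D, (p : ℂ) ^ Skeleton.beta3 c' D *
              (DirichletCharacter.changeLevel (Nat.dvd_mul_left r h) θs)⁻¹ (-(p : ZMod (h * r))) *
            Skeleton.DeltaW D ((l : ℝ) / ((p : ℝ) * ((h * r : ℕ) : ℝ)))‖ ≤
      Real.sqrt r * ‖frakS c' D a₁ r h d θs‖ := by
  have hgauss : ‖gaussBar (h * r) (DirichletCharacter.changeLevel (Nat.dvd_mul_left r h) θs)‖ ≤
      Real.sqrt r := hτ h r θs hh hr hθs
  -- the inner `p`-sum: `θ̄(−p) = θ̄*(−1) θ̄*(p)` since `p ∤ hr`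
  have hinner : ∀ l : ℕ,
      ∑ p ∈ Skeleton.primeWindow D, (p : ℂ) ^ Skeleton.beta3 c' D *
          (DirichletCharacter.changeLevel (Nat.dvd_mul_left r h) θs)⁻¹ (-(p : ZMod (h * r))) *
        Skeleton.DeltaW D ((l : ℝ) / ((p : ℝ) * ((h * r : ℕ) : ℝ))) =
      θs⁻¹ (-1) * ∑ p ∈ Skeleton.primeWindow D, (p : ℂ) ^ Skeleton.beta3 c' D *
          θs⁻¹ (p : ZMod r) * Skeleton.DeltaW D ((l : ℝ) / ((p : ℝ) * h * r)) := by
    intro l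
    rw [Finset.mul_sum]
    refine Finset.sum_congr rfl fun p hp => ?_
    have h1 : (DirichletCharacter.changeLevel (Nat.dvd_mul_left r h) θs)⁻¹ (-(p : ZMod (h * r))) =
        θs⁻¹ (-1) * θs⁻¹ (p : ZMod r) := by
      rw [← map_mul θs⁻¹, neg_one_mul,
        ← map_inv (DirichletCharacter.changeLevel (Nat.dvd_mul_left r h)) θs,
        changeLevel_neg_natCast _ _ (hcop p hp)]
    have h2 : ((l : ℝ) / ((p : ℝ) * ((h * r : ℕ) : ℝ))) = (l : ℝ) / ((p : ℝ) * h * r) := by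
      push_cast; ring
    rw [h1, h2]; ring
  -- termwise identity with the summand of `𝔰(r,h,d;θ*)`
  have hterm : ∀ l : ℕ,
      MeanSquareMajorant.conv (Skeleton.kappaZ c' D) a₁ (d * l) *
            DirichletCharacter.changeLevel (Nat.dvd_mul_left r h) θs (l : ZMod (h * r)) *
          ∑ p ∈ Skeleton.primeWindow D, (p : ℂ) ^ Skeleton.beta3 c' D *
              (DirichletCharacter.changeLevel (Nat.dvd_mul_left r h) θs)⁻¹ (-(p : ZMod (h * r))) *
            Skeleton.DeltaW D ((l : ℝ) / ((p : ℝ) * ((h * r : ℕ) : ℝ))) =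
        θs⁻¹ (-1) *
          (if Nat.Coprime l h then
            MeanSquareMajorant.conv (Skeleton.kappaZ c' D) a₁ (d * l) * θs (l : ZMod r) *
              ∑ p ∈ Skeleton.primeWindow D, (p : ℂ) ^ Skeleton.beta3 c' D * θs⁻¹ (p : ZMod r) *
                Skeleton.DeltaW D ((l : ℝ) / ((p : ℝ) * h * r))
          else 0) := by
    intro l
    rw [hinner l]
    by_cases hl : Nat.Coprime l h
    · rw [if_pos hl]
      by_cases hlr : Nat.Coprime l (h * r)
      · rw [changeLevel_natCast _ _ hlr]
        ring
      · have hlr' : ¬ Nat.Coprime l r := fun h' => hlr (Nat.Coprime.mul_right hl h')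
        rw [MulChar.map_nonunit (DirichletCharacter.changeLevel (Nat.dvd_mul_left r h) θs)
            (mt (ZMod.isUnit_iff_coprime l (h * r)).mp hlr),
          MulChar.map_nonunit θs (mt (ZMod.isUnit_iff_coprime l r).mp hlr')]
        simp
    · rw [if_neg hl]
      have hlk : ¬ Nat.Coprime l (h * r) := fun h' => hl (Nat.Coprime.coprime_mul_right_right h')
      rw [MulChar.map_nonunit (DirichletCharacter.changeLevel (Nat.dvd_mul_left r h) θs)
        (mt (ZMod.isUnit_iff_coprime l (h * r)).mp hlk)]
      simp
  have htsum :
      (∑' l : ℕ, MeanSquareMajorant.conv (Skeleton.kappaZ c' D) a₁ (d * l) *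
            DirichletCharacter.changeLevel (Nat.dvd_mul_left r h) θs (l : ZMod (h * r)) *
          ∑ p ∈ Skeleton.primeWindow D, (p : ℂ) ^ Skeleton.beta3 c' D *
              (DirichletCharacter.changeLevel (Nat.dvd_mul_left r h) θs)⁻¹ (-(p : ZMod (h * r))) *
            Skeleton.DeltaW D ((l : ℝ) / ((p : ℝ) * ((h * r : ℕ) : ℝ)))) =
        θs⁻¹ (-1) * frakS c' D a₁ r h d θs := by
    rw [frakS, ← tsum_mul_left]
    exact tsum_congr hterm
  rw [htsum, norm_mul, norm_mul]
  calc ‖gaussBar (h * r) (DirichletCharacter.changeLevel (Nat.dvd_mul_left r h) θs)‖ *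
          (‖θs⁻¹ (-1)‖ * ‖frakS c' D a₁ r h d θs‖) ≤
        Real.sqrt r * (1 * ‖frakS c' D a₁ r h d θs‖) := by
        gcongr
        exact DirichletCharacter.norm_le_one _ _
    _ = Real.sqrt r * ‖frakS c' D a₁ r h d θs‖ := by rw [one_mul]

/-! ## Re-indexing the non-principal characters by (conductor, primitive character) -/

open scoped Classical in
/-- Combinatorial re-indexing: a sum over `θ (mod k)` whose `θ ≠ 1` terms are bounded through
`(conductor θ, k / conductor θ, primitiveCharacter θ)` is bounded by the corresponding double sum
over `hr = k`, `r > 1`, `θ* (mod r)` primitive (the map is injective by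
`changeLevel_primitiveCharacter`). [folklore] -/
private theorem sum_le_sum_antidiagonal {k : ℕ} [NeZero k] (a : DirichletCharacter ℂ k → ℝ)
    (b : (r h : ℕ) → DirichletCharacter ℂ r → ℝ) (hb : ∀ r h ψ, 0 ≤ b r h ψ)
    (hab : ∀ θ : DirichletCharacter ℂ k, θ ≠ 1 →
      a θ ≤ Real.sqrt θ.conductor * b θ.conductor (k / θ.conductor) θ.primitiveCharacter)
    (ha1 : a 1 ≤ 0) :
    ∑ θ : DirichletCharacter ℂ k, a θ ≤
      ∑ x ∈ k.divisorsAntidiagonal,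
        if 1 < x.2 then
          Real.sqrt x.2 * ∑ θ : DirichletCharacter ℂ x.2, (if θ.IsPrimitive then b x.2 x.1 θ else 0)
        else 0 := by
  let g : (Σ x : ℕ × ℕ, DirichletCharacter ℂ x.2) → ℝ := fun y =>
    if 1 < y.1.2 then Real.sqrt y.1.2 * (if y.2.IsPrimitive then b y.1.2 y.1.1 y.2 else 0) else 0
  let j : DirichletCharacter ℂ k → (Σ x : ℕ × ℕ, DirichletCharacter ℂ x.2) := fun θ =>
    ⟨(k / θ.conductor, θ.conductor), θ.primitiveCharacter⟩
  have hg0 : ∀ y, 0 ≤ g y := by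
    intro y
    simp only [g]
    split_ifs
    · exact mul_nonneg (Real.sqrt_nonneg _) (hb _ _ _)
    · simp
    · exact le_rfl
  have hj : Function.Injective j := by
    intro θ₁ θ₂ hθ
    simp only [j, Sigma.mk.inj_iff, Prod.mk.injEq] at hθ
    obtain ⟨⟨_, hc⟩, hψ⟩ := hθ
    rw [← DirichletCharacter.changeLevel_primitiveCharacter θ₁,
      ← DirichletCharacter.changeLevel_primitiveCharacter θ₂]
    exact changeLevel_heq hc hψ _ _
  have hmaps : ∀ θ ∈ (Finset.univ : Finset (DirichletCharacter ℂ k)),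
      j θ ∈ (k.divisorsAntidiagonal).sigma
        (fun x => (Finset.univ : Finset (DirichletCharacter ℂ x.2))) := by
    intro θ _
    simp only [j, Finset.mem_sigma, Finset.mem_univ, and_true, Nat.mem_divisorsAntidiagonal]
    exact ⟨Nat.div_mul_cancel θ.conductor_dvd_level, NeZero.ne k⟩
  calc ∑ θ : DirichletCharacter ℂ k, a θ
      ≤ ∑ θ : DirichletCharacter ℂ k, g (j θ) := by
        refine Finset.sum_le_sum fun θ _ => ?_
        by_cases hθ : θ = 1
        · subst hθ
          exact ha1.trans (hg0 _)
        · have hc0 : θ.conductor ≠ 0 := DirichletCharacter.conductor_ne_zero θ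
          have hc1 : θ.conductor ≠ 1 := fun h =>
            hθ ((DirichletCharacter.eq_one_iff_conductor_eq_one (χ := θ)).mpr h)
          have h1 : 1 < θ.conductor := by omega
          have hgj : g (j θ) =
              Real.sqrt θ.conductor * b θ.conductor (k / θ.conductor) θ.primitiveCharacter := by
            simp only [g, j, if_pos h1, if_pos (DirichletCharacter.primitiveCharacter_isPrimitive θ)]
          rw [hgj]
          exact hab θ hθ
    _ = ∑ y ∈ (Finset.univ : Finset (DirichletCharacter ℂ k)).image j, g y :=
        (Finset.sum_image fun θ₁ _ θ₂ _ hθ => hj hθ).symm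
    _ ≤ ∑ y ∈ (k.divisorsAntidiagonal).sigma
          (fun x => (Finset.univ : Finset (DirichletCharacter ℂ x.2))), g y :=
        Finset.sum_le_sum_of_subset_of_nonneg (Finset.image_subset_iff.mpr hmaps)
          fun y _ _ => hg0 y
    _ = ∑ x ∈ k.divisorsAntidiagonal, ∑ θ : DirichletCharacter ℂ x.2, g ⟨x, θ⟩ :=
        Finset.sum_sigma _ _ _
    _ = _ := by
        refine Finset.sum_congr rfl fun x _ => ?_
        by_cases hx : 1 < x.2
        · simp only [g, if_pos hx]
          rw [Finset.mul_sum]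
        · simp only [g, if_neg hx, Finset.sum_const_zero]

/-! ## `§7.u031` holds -/

/-- On the support range `dk < PT⁻²`, every `p ∼ P` is coprime to `k` (indeed `p > P ≥ PT⁻² > dk ≥ k`).
[cite: Zhang2022LandauSiegel, §7 p. 37, tex L1998] -/
theorem coprime_of_mem_primeWindow_of_lt {D d k p : ℕ} (hd : 0 < d) (hk : 0 < k)
    (hdk : ((d * k : ℕ) : ℝ) < Skeleton.bigP D / Skeleton.bigT D ^ 2)
    (hp : p ∈ Skeleton.primeWindow D) : Nat.Coprime p k := by
  have hP : Skeleton.bigP D < p := Skeleton.bigP_lt_of_mem_primeWindow hp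
  have hT : 1 ≤ Skeleton.bigT D := by
    unfold Skeleton.bigT Skeleton.ell
    exact Real.one_le_exp (Real.rpow_nonneg (Real.log_natCast_nonneg D) _)
  have h1 : Skeleton.bigP D / Skeleton.bigT D ^ 2 ≤ Skeleton.bigP D :=
    div_le_self (Skeleton.bigP_pos D).le (one_le_pow₀ hT)
  have h2 : (k : ℝ) ≤ ((d * k : ℕ) : ℝ) := by exact_mod_cast Nat.le_mul_of_pos_left k hd
  have hkp : (k : ℝ) < p := (h2.trans_lt (hdk.trans_le h1)).trans hP
  exact Nat.coprime_of_lt_prime hk.ne' (by exact_mod_cast hkp) (Skeleton.prime_of_mem_primeWindow' hp)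

open scoped Classical in
/-- **`Z22:§7.u031` holds** (for every `c'`, with `C = 1`, `D₀ = 0`): the inner sum of (7.12) over the
non-principal `θ (mod k)` is at most `Σ_{hr=k, r>1} r^{1/2} Σ*_{θ mod r} |𝔰(r,h,d;θ)|` whenever
`dk < PT⁻²`. Discharges the typed claim `Section7cStatements.Step7u031` AS STATED (unconditionally:
Assumption (A) and (7.2) are not used). Inputs: `step7u031tau_holds` (`|τ(θ̄)| ≤ r^{1/2}`, slice
L2-t4) and Mathlib's conductor / primitive-character API.
[cite: Zhang2022LandauSiegel, §7 p. 37, tex L1997–L2001] -/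
theorem step7u031_holds (c' : ℝ) : Step7u031 c' := by
  intro B
  refine ⟨1, 0, fun D _ χ _ _ _ _ a₁ _ d k hd hk hdk => ?_⟩
  haveI : NeZero k := ⟨hk.ne'⟩
  have hcop : ∀ p ∈ Skeleton.primeWindow D, Nat.Coprime p k := fun p hp =>
    coprime_of_mem_primeWindow_of_lt hd hk hdk hp
  rw [one_mul]
  unfold innerSum712
  refine (norm_sum_le _ _).trans ?_
  refine sum_le_sum_antidiagonal (k := k) _
    (fun r h ψ => ‖frakS c' D a₁ r h d ψ‖) (fun _ _ _ => norm_nonneg _) ?_ ?_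
  swap
  · simp
  intro θ hθ
  rw [if_pos hθ]
  -- data of `θ`: conductor `r > 1`, cofactor `h = k / r > 0`, primitive `θ*`
  have hc0 : θ.conductor ≠ 0 := DirichletCharacter.conductor_ne_zero θ
  have hc1 : θ.conductor ≠ 1 := fun h =>
    hθ ((DirichletCharacter.eq_one_iff_conductor_eq_one (χ := θ)).mpr h)
  have hr : 1 < θ.conductor := by omega
  have hdvd : θ.conductor ∣ k := θ.conductor_dvd_level
  have hh : 0 < k / θ.conductor := Nat.div_pos (Nat.le_of_dvd hk hdvd) (Nat.pos_of_ne_zero hc0)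
  have hkeq : k = k / θ.conductor * θ.conductor := (Nat.div_mul_cancel hdvd).symm
  have hcop' : ∀ p ∈ Skeleton.primeWindow D, Nat.Coprime p (k / θ.conductor * θ.conductor) :=
    fun p hp => by rw [← hkeq]; exact hcop p hp
  have hkey := term_changeLevel_le step7u031tau_holds c' D a₁ d (k / θ.conductor) θ.conductor hh hr
    θ.primitiveCharacter (DirichletCharacter.primitiveCharacter_isPrimitive θ) hcop'
  have htr := changeLevel_transport
    (fun n (ψ : DirichletCharacter ℂ n) => gaussBar n ψ *
      ∑' l : ℕ, MeanSquareMajorant.conv (Skeleton.kappaZ c' D) a₁ (d * l) * ψ (l : ZMod n) *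
        ∑ p ∈ Skeleton.primeWindow D, (p : ℂ) ^ Skeleton.beta3 c' D * ψ⁻¹ (-(p : ZMod n)) *
          Skeleton.DeltaW D ((l : ℝ) / ((p : ℝ) * n)))
    hkeq θ.conductor_dvd_level (Nat.dvd_mul_left θ.conductor (k / θ.conductor)) θ.primitiveCharacter
  simp only [DirichletCharacter.changeLevel_primitiveCharacter] at htr
  rw [htr]
  exact hkey

end Literature.NumberTheory.LFunctions.Zhang2022.Section7cStatements

end
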